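import Mathlib

/-!
# Stub `stub_coreSplit` (line `atkinson-lloyd-core-split`, crux stmt-MatrixMultiplication-10752)

Support file for crux item `stmt-MatrixMultiplication-10752`
(`Summit.MatrixMultiplication.MatrixMultiplication.Theses.HiddenToeplitzCorners.HiddenCornerLemmaR`),
line `atkinson-lloyd-core-split`, registered stub `stub_coreSplit`: the pull-back of the
Atkinson–Lloyd normal form through the pencil (pure bookkeeping).

Notation (written out verbatim in the statements): `Z` is the lower shift on `ℂ^N`
(`Z i j = [i = j + 1]`), `∇M = M − Z M Zᵀ` the Stein displacement, `T(X) = Σ X a b • T a b`.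

Statement.  HYPOTHESIS (the normal form, produced by the neighbouring stubs): every subspace `V`
of `m × n` complex matrices of rank `≤ d` admits invertible `P, Q` and finsets `BR, CR` (rows),
`BC, CC` (columns), `BR ∩ CR = ∅ = BC ∩ CC`, and `ρ` with `#BR + #BC + ρ ≤ d`,
`2 #CR, 2 #CC ≤ ρ (ρ + 1)`, such that every `P M Q` (`M ∈ V`) is supported on
`BR × all ∪ all × BC ∪ CR × CC` and the matrix `P M Q` with border rows/columns blanked has rank
`≤ ρ`.  CONCLUSION: for every pencil `T` with `rank ∇T(X) ≤ d` for all `X` there are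
`p q ρ m₀ n₀` with `p + q + ρ ≤ d`, `2 m₀, 2 n₀ ≤ ρ (ρ + 1)` and constant matrices
`G₀ : N × p`, `H₀ : N × q`, `Γ : N × m₀`, `Θ : N × n₀` with `rank G₀ = p`, `rank H₀ = q`,
`rank [G₀ | Γ] = p + m₀`, `rank [H₀ | Θ] = q + n₀`, and varying `H₁ a b`, `G₁ a b`, `C a b` with
`rank C(X) ≤ ρ` and `∇(T a b) = G₀ (H₁ a b)ᵀ + (G₁ a b) H₀ᵀ + Γ (C a b) Θᵀ`.

Proof.  Apply the hypothesis to `V := span {∇(T a b)}`; every member of `V` is `∇T(X)` for its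
coefficient matrix `X` (`∇` is linear), hence of rank `≤ d`.  Enumerate `BR, BC, CR, CC` by
`Fin #BR, …`; put `G₀ :=` the columns of `P⁻¹` indexed by `BR`, `Γ :=` those indexed by `CR`,
`H₀ :=` (the rows of `Q⁻¹` indexed by `BC`)ᵀ, `Θ` likewise for `CC`.  With `S := P ∇(T a b) Q`
split `S = R + K + W` (`R` = the rows in `BR`; `K` = the entries with column in `BC` and row
outside `BR`; `W` = the `CR × CC` block — the support clause and the two disjointness clauses
say nothing else is left), and `∇(T a b) = P⁻¹ S Q⁻¹`; then `P⁻¹ R Q⁻¹ = G₀ (H₁ a b)ᵀ` with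
`H₁ a b := (rows BR of S Q⁻¹)ᵀ`, `P⁻¹ K Q⁻¹ = (G₁ a b) H₀ᵀ` with `G₁ a b :=` columns `BC` of
`P⁻¹ K`, `P⁻¹ W Q⁻¹ = Γ (C a b) Θᵀ` with `C a b :=` the `CR × CC` block of `S`.  The columns of
`P⁻¹` (rows of `Q⁻¹`) along an injective index map have full column rank (`P` restricted to the
same rows is a left inverse), which gives the four rank identities (`BR ∩ CR = ∅` makes the
combined index map of `[G₀ | Γ]` injective).  Finally `C(X)` is a submatrix of the blanked
matrix of `P ∇T(X) Q` (rows in `CR` are outside `BR`, columns in `CC` outside `BC`), so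
`rank C(X) ≤ ρ` by `Matrix.rank_submatrix_le`. [folklore]
-/

set_option linter.dupNamespace false

namespace Summit.MatrixMultiplication.MatrixMultiplication.Cruxes.HiddenCornerLemmaR.AtkinsonLloydCoreSplit

open Matrix

/-- Stein displacement is linear in the pencil variable (the skeleton's `stein_pencil`). -/
private theorem coreSplit_stein_pencil (r N : ℕ) (T : Fin r → Fin r → Matrix (Fin N) (Fin N) ℂ)
    (X : Matrix (Fin r) (Fin r) ℂ) :
    (∑ a : Fin r, ∑ b : Fin r, X a b • T a b) - (Matrix.of fun i j : Fin N => if (i : ℕ) = (j : ℕ) + 1 then (1 : ℂ) else 0) * (∑ a : Fin r, ∑ b : Fin r, X a b • T a b) * (Matrix.of fun i j : Fin N => if (i : ℕ) = (j : ℕ) + 1 then (1 : ℂ) else 0)ᵀ =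
      ∑ a : Fin r, ∑ b : Fin r, X a b • (T a b - (Matrix.of fun i j : Fin N => if (i : ℕ) = (j : ℕ) + 1 then (1 : ℂ) else 0) * T a b * (Matrix.of fun i j : Fin N => if (i : ℕ) = (j : ℕ) + 1 then (1 : ℂ) else 0)ᵀ) := by
  simp only [smul_sub, Finset.sum_sub_distrib, Finset.mul_sum, Finset.sum_mul, Matrix.mul_smul,
    Matrix.smul_mul]

/-- Enumeration of a finset `s` of `Fin N` by `Fin #s`: an injection with values in `s` along
which sums are the `s`-indicator-weighted sums over `Fin N`. -/
private theorem coreSplit_enum {N : ℕ} (s : Finset (Fin N)) :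
    ∃ f : Fin s.card → Fin N, Function.Injective f ∧ (∀ k, f k ∈ s) ∧
      ∀ g : Fin N → ℂ, ∑ k, g (f k) = ∑ i, if i ∈ s then g i else 0 := by
  refine ⟨fun k => ((s.equivFin.symm k : s) : Fin N),
    Subtype.val_injective.comp s.equivFin.symm.injective, fun k => (s.equivFin.symm k).2,
    fun g => ?_⟩
  have h1 : ∑ k : Fin s.card, g ((s.equivFin.symm k : s) : Fin N) = ∑ x : s, g (x : Fin N) :=
    Equiv.sum_comp s.equivFin.symm (fun x : s => g (x : Fin N))
  rw [h1, Finset.sum_coe_sort s g, Fintype.sum_extend_by_zero]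

/-- The columns of a matrix `B` with a left inverse (`A * B = 1`), taken along an injective index
map, have full column rank. -/
private theorem coreSplit_rank_cols {N : ℕ} {ι : Type} [Fintype ι] (A B : Matrix (Fin N) (Fin N) ℂ)
    (hAB : A * B = 1) (f : ι → Fin N) (hf : Function.Injective f) :
    (B.submatrix id f).rank = Fintype.card ι := by
  classical
  refine le_antisymm (Matrix.rank_le_card_width _) ?_
  have h : A.submatrix f id * B.submatrix id f = 1 := by
    have h' : A.submatrix f (Equiv.refl (Fin N)) * B.submatrix (Equiv.refl (Fin N)) f =
        (A * B).submatrix f f :=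
      Matrix.submatrix_mul_equiv A B f (Equiv.refl (Fin N)) f
    rw [hAB, Matrix.submatrix_one f hf] at h'
    simpa only [Equiv.coe_refl] using h'
  calc Fintype.card ι = (1 : Matrix ι ι ℂ).rank := Matrix.rank_one.symm
    _ = (A.submatrix f id * B.submatrix id f).rank := by rw [h]
    _ ≤ (B.submatrix id f).rank := Matrix.rank_mul_le_right _ _

/-- Two families of columns of `B` side by side are the columns of `B` along `Sum.elim`. -/
private theorem coreSplit_fromCols {N : ℕ} {ι κ : Type} (B : Matrix (Fin N) (Fin N) ℂ)
    (f : ι → Fin N) (g : κ → Fin N) :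
    Matrix.fromCols (B.submatrix id f) (B.submatrix id g) = B.submatrix id (Sum.elim f g) := by
  ext i (k | k) <;> simp

/-- A matrix supported on `BR × all ∪ all × BC ∪ CR × CC` (`BR ∩ CR = ∅ = BC ∩ CC`) splits as
(rows in `BR`) + (columns in `BC`, rows outside `BR`) + (the `CR × CC` block). -/
private theorem coreSplit_split {N : ℕ} (BR CR BC CC : Finset (Fin N)) (hR : Disjoint BR CR)
    (hC : Disjoint BC CC) (S : Matrix (Fin N) (Fin N) ℂ)
    (hS : ∀ i j, S i j ≠ 0 → i ∈ BR ∨ j ∈ BC ∨ (i ∈ CR ∧ j ∈ CC)) :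
    S = Matrix.of (fun x y => if x ∈ BR then S x y else 0) +
      Matrix.of (fun x y => if x ∉ BR ∧ y ∈ BC then S x y else 0) +
      Matrix.of (fun x y => if x ∈ CR ∧ y ∈ CC then S x y else 0) := by
  ext i j
  simp only [Matrix.add_apply, Matrix.of_apply]
  by_cases hi : i ∈ BR
  · have hic : i ∉ CR := Finset.disjoint_left.mp hR hi
    simp [hi, hic]
  · by_cases hj : j ∈ BC
    · have hjc : j ∉ CC := Finset.disjoint_left.mp hC hj
      simp [hi, hj, hjc]
    · by_cases hc : i ∈ CR ∧ j ∈ CC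
      · simp [hi, hj, hc.1, hc.2]
      · have h0 : S i j = 0 := by
          by_contra h
          rcases hS i j h with h' | h' | h'
          · exact hi h'
          · exact hj h'
          · exact hc h'
        simp [h0]

/-- Border-row term: `A R B = G₀ (H₁)ᵀ` with `G₀` the columns of `A` indexed by `BR` and
`H₁ := (rows BR of S B)ᵀ`. -/
private theorem coreSplit_rowTerm {N : ℕ} {ι : Type} [Fintype ι] (BR : Finset (Fin N))
    (f : ι → Fin N) (hf : ∀ φ : Fin N → ℂ, ∑ k, φ (f k) = ∑ i, if i ∈ BR then φ i else 0)
    (A S B : Matrix (Fin N) (Fin N) ℂ) :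
    A * Matrix.of (fun x y => if x ∈ BR then S x y else 0) * B =
      A.submatrix id f * (((S * B).submatrix f id)ᵀ)ᵀ := by
  ext i j
  have hRB : ∀ x, (Matrix.of (fun x y => if x ∈ BR then S x y else 0) * B) x j =
      if x ∈ BR then (S * B) x j else 0 := by
    intro x
    by_cases hx : x ∈ BR <;> simp [Matrix.mul_apply, hx]
  rw [Matrix.transpose_transpose, Matrix.mul_assoc, Matrix.mul_apply, Matrix.mul_apply]
  simp only [Matrix.submatrix_apply, id_eq, hRB]
  rw [hf (fun x => A i x * (S * B) x j)]
  refine Finset.sum_congr rfl fun x _ => ?_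
  split_ifs <;> simp

/-- Border-column term: `A K B = (G₁) H₀ᵀ` with `H₀ := (rows BC of B)ᵀ` and `G₁ :=` the columns
of `A K` indexed by `BC`. -/
private theorem coreSplit_colTerm {N : ℕ} {ι : Type} [Fintype ι] (BR BC : Finset (Fin N))
    (f : ι → Fin N) (hf : ∀ φ : Fin N → ℂ, ∑ k, φ (f k) = ∑ i, if i ∈ BC then φ i else 0)
    (A S B : Matrix (Fin N) (Fin N) ℂ) :
    A * Matrix.of (fun x y => if x ∉ BR ∧ y ∈ BC then S x y else 0) * B =
      (A * Matrix.of (fun x y => if x ∉ BR ∧ y ∈ BC then S x y else 0)).submatrix id f *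
        (Bᵀ.submatrix id f)ᵀ := by
  ext i j
  rw [Matrix.mul_apply, Matrix.transpose_submatrix, Matrix.transpose_transpose, Matrix.mul_apply]
  simp only [Matrix.submatrix_apply, id_eq]
  rw [hf (fun y => (A * Matrix.of (fun x y => if x ∉ BR ∧ y ∈ BC then S x y else 0)) i y * B y j)]
  refine Finset.sum_congr rfl fun y _ => ?_
  split_ifs with hy
  · rfl
  · have h0 : (A * Matrix.of (fun x y => if x ∉ BR ∧ y ∈ BC then S x y else 0)) i y = 0 := by
      simp [Matrix.mul_apply, hy]
    rw [h0, zero_mul]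

/-- Core term: `A W B = Γ C Θᵀ` with `Γ` the columns of `A` indexed by `CR`, `Θ := (rows CC of B)ᵀ`
and `C :=` the `CR × CC` block of `S`. -/
private theorem coreSplit_coreTerm {N : ℕ} {ι κ : Type} [Fintype ι] [Fintype κ]
    (CR CC : Finset (Fin N)) (f : ι → Fin N) (g : κ → Fin N)
    (hf : ∀ φ : Fin N → ℂ, ∑ k, φ (f k) = ∑ i, if i ∈ CR then φ i else 0)
    (hg : ∀ φ : Fin N → ℂ, ∑ k, φ (g k) = ∑ i, if i ∈ CC then φ i else 0)
    (A S B : Matrix (Fin N) (Fin N) ℂ) :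
    A * Matrix.of (fun x y => if x ∈ CR ∧ y ∈ CC then S x y else 0) * B =
      A.submatrix id f * S.submatrix f g * (Bᵀ.submatrix id g)ᵀ := by
  ext i j
  simp only [Matrix.mul_apply, Matrix.transpose_submatrix, Matrix.transpose_transpose,
    Matrix.submatrix_apply, id_eq, Matrix.of_apply]
  rw [hg (fun y => (∑ k, A i (f k) * S (f k) y) * B y j)]
  refine Finset.sum_congr rfl fun y _ => ?_
  rw [hf (fun x => A i x * S x y)]
  by_cases hy : y ∈ CC
  · rw [if_pos hy]
    congr 1
    refine Finset.sum_congr rfl fun x _ => ?_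
    by_cases hx : x ∈ CR <;> simp [hx, hy]
  · rw [if_neg hy]
    have h0 : ∑ x, A i x * (if x ∈ CR ∧ y ∈ CC then S x y else 0) = 0 := by
      refine Finset.sum_eq_zero fun x _ => ?_
      simp [hy]
    rw [h0, zero_mul]

/-- The bookkeeping core of `stub_coreSplit`, for an arbitrary family `D a b` (in the stub,
`D a b = ∇(T a b)`) whose linear combinations all have rank `≤ d`. -/
private theorem coreSplit_main
    (hNF : ∀ (m n d : ℕ) (V : Submodule ℂ (Matrix (Fin m) (Fin n) ℂ)), (∀ M ∈ V, M.rank ≤ d) →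
      ∃ (P : Matrix (Fin m) (Fin m) ℂ) (Q : Matrix (Fin n) (Fin n) ℂ), IsUnit P ∧ IsUnit Q ∧
        ∃ (BR CR : Finset (Fin m)) (BC CC : Finset (Fin n)) (ρ : ℕ),
          Disjoint BR CR ∧ Disjoint BC CC ∧ BR.card + BC.card + ρ ≤ d ∧
          2 * CR.card ≤ ρ * (ρ + 1) ∧ 2 * CC.card ≤ ρ * (ρ + 1) ∧
          (∀ M ∈ V, ∀ (i : Fin m) (j : Fin n), (P * M * Q) i j ≠ 0 →
            i ∈ BR ∨ j ∈ BC ∨ (i ∈ CR ∧ j ∈ CC)) ∧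
          (∀ M ∈ V, (Matrix.of fun (i : Fin m) (j : Fin n) =>
            if i ∈ BR ∨ j ∈ BC then (0 : ℂ) else (P * M * Q) i j).rank ≤ ρ))
    (r N d : ℕ) (D : Fin r → Fin r → Matrix (Fin N) (Fin N) ℂ)
    (hdisp : ∀ X : Matrix (Fin r) (Fin r) ℂ, (∑ a : Fin r, ∑ b : Fin r, X a b • D a b).rank ≤ d) :
    ∃ (p q ρ m₀ n₀ : ℕ), p + q + ρ ≤ d ∧ 2 * m₀ ≤ ρ * (ρ + 1) ∧ 2 * n₀ ≤ ρ * (ρ + 1) ∧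
      ∃ (G₀ : Matrix (Fin N) (Fin p) ℂ) (H₀ : Matrix (Fin N) (Fin q) ℂ)
        (Γ : Matrix (Fin N) (Fin m₀) ℂ) (Θ : Matrix (Fin N) (Fin n₀) ℂ)
        (H₁ : Fin r → Fin r → Matrix (Fin N) (Fin p) ℂ) (G₁ : Fin r → Fin r → Matrix (Fin N) (Fin q) ℂ)
        (C : Fin r → Fin r → Matrix (Fin m₀) (Fin n₀) ℂ),
        G₀.rank = p ∧ H₀.rank = q ∧ (Matrix.fromCols G₀ Γ).rank = p + m₀ ∧
        (Matrix.fromCols H₀ Θ).rank = q + n₀ ∧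
        (∀ X : Matrix (Fin r) (Fin r) ℂ, (∑ a : Fin r, ∑ b : Fin r, X a b • C a b).rank ≤ ρ) ∧
        (∀ a b, D a b = G₀ * (H₁ a b)ᵀ + G₁ a b * H₀ᵀ + Γ * C a b * Θᵀ) := by
  -- the span of the family and its rank bound
  set V : Submodule ℂ (Matrix (Fin N) (Fin N) ℂ) :=
    Submodule.span ℂ (Set.range fun ab : Fin r × Fin r => D ab.1 ab.2) with hV
  have hVrank : ∀ M ∈ V, M.rank ≤ d := by
    intro M hM
    obtain ⟨c, rfl⟩ := (Submodule.mem_span_range_iff_exists_fun ℂ).mp hM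
    have h := hdisp (Matrix.of fun a b => c (a, b))
    simp only [Matrix.of_apply] at h
    simpa only [Fintype.sum_prod_type] using h
  have hDmem : ∀ a b, D a b ∈ V := fun a b => Submodule.subset_span ⟨(a, b), rfl⟩
  have hDXmem : ∀ X : Matrix (Fin r) (Fin r) ℂ, (∑ a, ∑ b, X a b • D a b) ∈ V := fun X =>
    Submodule.sum_mem _ fun a _ => Submodule.sum_mem _ fun b _ => Submodule.smul_mem _ _ (hDmem a b)
  -- the normal form of `V`
  obtain ⟨P, Q, hP, hQ, BR, CR, BC, CC, ρ, hdisjR, hdisjC, hbud, hCR, hCC, hsupp, hcore⟩ :=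
    hNF N N d V hVrank
  have hPdet : IsUnit P.det := (Matrix.isUnit_iff_isUnit_det P).mp hP
  have hQdet : IsUnit Q.det := (Matrix.isUnit_iff_isUnit_det Q).mp hQ
  have hPi : P * P⁻¹ = 1 := Matrix.mul_nonsing_inv P hPdet
  have hPi' : P⁻¹ * P = 1 := Matrix.nonsing_inv_mul P hPdet
  have hQi : Q * Q⁻¹ = 1 := Matrix.mul_nonsing_inv Q hQdet
  have hQi' : Q⁻¹ * Q = 1 := Matrix.nonsing_inv_mul Q hQdet
  have hQT : Qᵀ * (Q⁻¹)ᵀ = 1 := by rw [← Matrix.transpose_mul, hQi', Matrix.transpose_one]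
  -- enumerations of the four index sets
  obtain ⟨fR, hfR_inj, hfR_mem, hfR_sum⟩ := coreSplit_enum BR
  obtain ⟨fC, hfC_inj, hfC_mem, hfC_sum⟩ := coreSplit_enum BC
  obtain ⟨fCR, hfCR_inj, hfCR_mem, hfCR_sum⟩ := coreSplit_enum CR
  obtain ⟨fCC, hfCC_inj, hfCC_mem, hfCC_sum⟩ := coreSplit_enum CC
  have hRCR : Function.Injective (Sum.elim fR fCR) := hfR_inj.sumElim hfCR_inj fun k l h =>
    Finset.disjoint_left.mp hdisjR (hfR_mem k) (by rw [h]; exact hfCR_mem l)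
  have hCCC : Function.Injective (Sum.elim fC fCC) := hfC_inj.sumElim hfCC_inj fun k l h =>
    Finset.disjoint_left.mp hdisjC (hfC_mem k) (by rw [h]; exact hfCC_mem l)
  -- the four rank identities
  have h1 : (P⁻¹.submatrix id fR).rank = BR.card := by
    rw [coreSplit_rank_cols P P⁻¹ hPi fR hfR_inj, Fintype.card_fin]
  have h2 : ((Q⁻¹)ᵀ.submatrix id fC).rank = BC.card := by
    rw [coreSplit_rank_cols Qᵀ (Q⁻¹)ᵀ hQT fC hfC_inj, Fintype.card_fin]
  have h3 : (Matrix.fromCols (P⁻¹.submatrix id fR) (P⁻¹.submatrix id fCR)).rank =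
      BR.card + CR.card := by
    rw [coreSplit_fromCols, coreSplit_rank_cols P P⁻¹ hPi _ hRCR]
    simp only [Fintype.card_sum, Fintype.card_fin]
  have h4 : (Matrix.fromCols ((Q⁻¹)ᵀ.submatrix id fC) ((Q⁻¹)ᵀ.submatrix id fCC)).rank =
      BC.card + CC.card := by
    rw [coreSplit_fromCols, coreSplit_rank_cols Qᵀ (Q⁻¹)ᵀ hQT _ hCCC]
    simp only [Fintype.card_sum, Fintype.card_fin]
  -- the core has rank `≤ ρ` throughout the pencil
  have h5 : ∀ X : Matrix (Fin r) (Fin r) ℂ,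
      (∑ a : Fin r, ∑ b : Fin r, X a b • (P * D a b * Q).submatrix fCR fCC).rank ≤ ρ := by
    intro X
    refine le_trans ?_ (hcore _ (hDXmem X))
    have hPMQ : P * (∑ a, ∑ b, X a b • D a b) * Q = ∑ a, ∑ b, X a b • (P * D a b * Q) := by
      simp only [Finset.mul_sum, Finset.sum_mul, Matrix.mul_smul, Matrix.smul_mul]
    have heq : (∑ a, ∑ b, X a b • (P * D a b * Q).submatrix fCR fCC) =
        (Matrix.of fun i j : Fin N => if i ∈ BR ∨ j ∈ BC then (0 : ℂ) else
          (P * (∑ a, ∑ b, X a b • D a b) * Q) i j).submatrix fCR fCC := by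
      ext k l
      have hk : fCR k ∉ BR := fun h => Finset.disjoint_left.mp hdisjR h (hfCR_mem k)
      have hl : fCC l ∉ BC := fun h => Finset.disjoint_left.mp hdisjC h (hfCC_mem l)
      simp only [hPMQ, Matrix.submatrix_apply, Matrix.of_apply, hk, hl, or_self, if_false,
        Matrix.sum_apply, Matrix.smul_apply, smul_eq_mul]
    rw [heq]
    exact Matrix.rank_submatrix_le _ _ _
  -- the decomposition of every `D a b`
  have h6 : ∀ a b, D a b =
      P⁻¹.submatrix id fR * ((((P * D a b * Q) * Q⁻¹).submatrix fR id)ᵀ)ᵀ +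
      (P⁻¹ * Matrix.of (fun x y => if x ∉ BR ∧ y ∈ BC then (P * D a b * Q) x y else 0)).submatrix
          id fC * ((Q⁻¹)ᵀ.submatrix id fC)ᵀ +
      P⁻¹.submatrix id fCR * (P * D a b * Q).submatrix fCR fCC * ((Q⁻¹)ᵀ.submatrix id fCC)ᵀ := by
    intro a b
    have hS := coreSplit_split BR CR BC CC hdisjR hdisjC (P * D a b * Q)
      (hsupp (D a b) (hDmem a b))
    have hrec : D a b = P⁻¹ * (P * D a b * Q) * Q⁻¹ := by
      rw [show P⁻¹ * (P * D a b * Q) * Q⁻¹ = (P⁻¹ * P) * D a b * (Q * Q⁻¹) by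
        simp only [Matrix.mul_assoc], hPi', hQi, Matrix.one_mul, Matrix.mul_one]
    rw [← coreSplit_rowTerm BR fR hfR_sum P⁻¹ (P * D a b * Q) Q⁻¹,
      ← coreSplit_colTerm BR BC fC hfC_sum P⁻¹ (P * D a b * Q) Q⁻¹,
      ← coreSplit_coreTerm CR CC fCR fCC hfCR_sum hfCC_sum P⁻¹ (P * D a b * Q) Q⁻¹,
      ← Matrix.add_mul, ← Matrix.add_mul, ← Matrix.mul_add, ← Matrix.mul_add, ← hS]
    exact hrec
  exact ⟨BR.card, BC.card, ρ, CR.card, CC.card, hbud, hCR, hCC,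
    P⁻¹.submatrix id fR, (Q⁻¹)ᵀ.submatrix id fC, P⁻¹.submatrix id fCR, (Q⁻¹)ᵀ.submatrix id fCC,
    fun a b => ((((P * D a b * Q) * Q⁻¹).submatrix fR id)ᵀ),
    fun a b => (P⁻¹ * Matrix.of (fun x y => if x ∉ BR ∧ y ∈ BC then (P * D a b * Q) x y else 0)).submatrix
      id fC,
    fun a b => (P * D a b * Q).submatrix fCR fCC, h1, h2, h3, h4, h5, h6⟩

/-- **stub 2 — `stub_coreSplit`: pull-back of the normal form through the pencil.**
From the normal form (the hypothesis) applied to the displacement space `V := span {∇T a b}` (all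
of whose members are `∇T(X)` for the coefficient matrix `X`, hence of rank `≤ d`): with
`S a b := P (∇T a b) Q`, split `S = R + K + W` (rows in BR; columns in BC outside BR; the rest,
which the support clause puts inside `CR × CC`), and expand `∇T a b = P⁻¹ S Q⁻¹` along columns
of `P⁻¹` / rows of `Q⁻¹`: `G₀ :=` columns of `P⁻¹` indexed by BR, `H₀ :=` rows of `Q⁻¹` indexed
by BC, `Γ, Θ` likewise for CR, CC, `H₁ a b := (rows BR of S Q⁻¹)ᵀ`, `G₁ a b :=` columns BC of
`P⁻¹ K`, `C a b :=` the CR × CC block of `S a b`.  Full column rank of `[G₀ | Γ]` and `[H₀ | Θ]`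
because BR ∩ CR = ∅ = BC ∩ CC index distinct columns (rows) of an invertible matrix;
`rank C(X) ≤ ρ` is the core clause at `M := ∇T(X)` (`Matrix.rank_submatrix_le`). -/
theorem stub_coreSplit :
    (∀ (m n d : ℕ) (V : Submodule ℂ (Matrix (Fin m) (Fin n) ℂ)), (∀ M ∈ V, M.rank ≤ d) →
      ∃ (P : Matrix (Fin m) (Fin m) ℂ) (Q : Matrix (Fin n) (Fin n) ℂ), IsUnit P ∧ IsUnit Q ∧
        ∃ (BR CR : Finset (Fin m)) (BC CC : Finset (Fin n)) (ρ : ℕ),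
          Disjoint BR CR ∧ Disjoint BC CC ∧ BR.card + BC.card + ρ ≤ d ∧
          2 * CR.card ≤ ρ * (ρ + 1) ∧ 2 * CC.card ≤ ρ * (ρ + 1) ∧
          (∀ M ∈ V, ∀ (i : Fin m) (j : Fin n), (P * M * Q) i j ≠ 0 →
            i ∈ BR ∨ j ∈ BC ∨ (i ∈ CR ∧ j ∈ CC)) ∧
          (∀ M ∈ V, (Matrix.of fun (i : Fin m) (j : Fin n) =>
            if i ∈ BR ∨ j ∈ BC then (0 : ℂ) else (P * M * Q) i j).rank ≤ ρ)) →
    ∀ (r N d : ℕ) (T : Fin r → Fin r → Matrix (Fin N) (Fin N) ℂ),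
    (∀ X : Matrix (Fin r) (Fin r) ℂ, ((∑ a : Fin r, ∑ b : Fin r, X a b • T a b) - (Matrix.of fun i j : Fin N => if (i : ℕ) = (j : ℕ) + 1 then (1 : ℂ) else 0) * (∑ a : Fin r, ∑ b : Fin r, X a b • T a b) * (Matrix.of fun i j : Fin N => if (i : ℕ) = (j : ℕ) + 1 then (1 : ℂ) else 0)ᵀ).rank ≤ d) →
    ∃ (p q ρ m₀ n₀ : ℕ), p + q + ρ ≤ d ∧ 2 * m₀ ≤ ρ * (ρ + 1) ∧ 2 * n₀ ≤ ρ * (ρ + 1) ∧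
      ∃ (G₀ : Matrix (Fin N) (Fin p) ℂ) (H₀ : Matrix (Fin N) (Fin q) ℂ)
        (Γ : Matrix (Fin N) (Fin m₀) ℂ) (Θ : Matrix (Fin N) (Fin n₀) ℂ)
        (H₁ : Fin r → Fin r → Matrix (Fin N) (Fin p) ℂ) (G₁ : Fin r → Fin r → Matrix (Fin N) (Fin q) ℂ)
        (C : Fin r → Fin r → Matrix (Fin m₀) (Fin n₀) ℂ),
        G₀.rank = p ∧ H₀.rank = q ∧ (Matrix.fromCols G₀ Γ).rank = p + m₀ ∧
        (Matrix.fromCols H₀ Θ).rank = q + n₀ ∧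
        (∀ X : Matrix (Fin r) (Fin r) ℂ, (∑ a : Fin r, ∑ b : Fin r, X a b • C a b).rank ≤ ρ) ∧
        (∀ a b, T a b - (Matrix.of fun i j : Fin N => if (i : ℕ) = (j : ℕ) + 1 then (1 : ℂ) else 0) * T a b * (Matrix.of fun i j : Fin N => if (i : ℕ) = (j : ℕ) + 1 then (1 : ℂ) else 0)ᵀ = G₀ * (H₁ a b)ᵀ + G₁ a b * H₀ᵀ + Γ * C a b * Θᵀ) := by
  intro hNF r N d T hdisp
  exact coreSplit_main hNF r N d
    (fun a b => T a b - (Matrix.of fun i j : Fin N => if (i : ℕ) = (j : ℕ) + 1 then (1 : ℂ) else 0) * T a b * (Matrix.of fun i j : Fin N => if (i : ℕ) = (j : ℕ) + 1 then (1 : ℂ) else 0)ᵀ)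
    fun X => by
      have h := hdisp X
      rw [coreSplit_stein_pencil] at h
      exact h

end Summit.MatrixMultiplication.MatrixMultiplication.Cruxes.HiddenCornerLemmaR.AtkinsonLloydCoreSplit
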